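import Literature.Probability.Percolation.SharpnessDCTProofs
import Literature.Probability.Percolation.ConstrainedClusters
import Literature.Probability.Percolation.UniquenessInfiniteCluster
import Literature.Probability.Percolation.LocalEvents
import HarnessLib

/-!
# Connection events under local limits: `μ[x ↔ y]` from box-constrained bounds, and vanishing of exit probabilities

Topic `Literature/Probability/Percolation`, namespace `Literature.StatMech`. Two limit interchanges for a
measure `μ` on bond configurations which is the **local limit** of finite-volume measures `μ_L`
(`μ_L(A) → μ(A)` for every local event `A`, the form produced by
`exists_measure_tendsto_of_isLocalEvent` of `LocalLimitMeasure.lean`), as used in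

* M. Aizenman, H. Duminil-Copin, V. Sidoravicius, *Random currents and continuity of Ising
  model's spontaneous magnetization*, Comm. Math. Phys. **334** (2015) 719–742 (arXiv:1311.1937v3
  numbering; bib key `AizenmanDuminilCopinSidoraviciusCMP2015`), proof of Thm. 3.1 and §3.2:

1. (proof of Thm. 3.1, after (3.3): "The percolation event does not depend on finitely many edges,
   but justifying passing to the limit is straightforward by first considering the events that
   `0` is connected to distance `N`") — `{x ↔ y} = ⋃_N {x ↔ y inside Λ_N}` is an increasing union
   of local events, so a bound `μ_L[x ↔ y inside Λ_N] ≤ τ` valid for all `N` and all large `L`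
   passes to `μ[x ↔ y] ≤ τ` (`measure_openConn_le_of_eventually_le`);
2. (§3.2, the parenthetical remark after (3.11): "justifying passing to the limit … by first
   considering the events that `x` is connected to distance `N`", in `Λ_L` for `L ≥ N`) — if events
   `E_L` are eventually contained in each of a sequence of local events `A_n` whose intersection is
   `μ`-null (e.g. `A_n = {x ↔ ∂(x + Λ_n)}`, `⋂ A_n ⊆ {x ↔ ∞}`, `μ[x ↔ ∞] = 0`), then `μ_L(E_L) → 0`
   (`tendsto_measure_zero_of_eventually_subset`, `tendsto_measure_zero_of_subset_armEvent`).

Also recorded: the box-constrained connection events `openConnVia (withinGraph ⊤ Λ_N) x y` are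
local (`isLocalEvent_openConnVia_withinGraph_box`) and exhaust `{x ↔ y}`
(`openConn_eq_iUnion_openConnVia_box`); the translated one-arm events `armEvent x n` of
`SharpnessDCT.lean` are local (`isLocalEvent_armEvent`) and `⋂ₙ armEvent x n ⊆ {x ↔ ∞}`
(`iInter_armEvent_subset_percolatesAt`).

## Mathlib status

Anchors: `MeasureTheory.tendsto_measure_iUnion_atTop`, `MeasureTheory.tendsto_measure_iInter_atTop`,
`ENNReal.tendsto_nhds_zero`, `Filter.eventually_all_finset`, `SimpleGraph.Walk` induction; tree:
`openConn`, `openConnVia`, `withinGraph`, `openClusterIn_subset_openCluster`,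
`determinedBy_openConnVia` (`ConstrainedClusters.lean`), `siteToBoundary`, `DCT16.armEvent`,
`determinedBy_siteToBoundary`, `preimage_shift_siteToBoundary`,
`iInter_siteToBoundary_subset_percolatesAt`, `exists_subset_box` (`SharpnessDCTProofs.lean`),
`relabel_mem_percolatesAt_iff` (`UniquenessInfiniteCluster.lean`).
-/

noncomputable section

namespace Literature.Probability.Percolation

open MeasureTheory Filter Topology SimpleGraph
open DCT16 (armEvent preimage_shift_siteToBoundary determinedBy_siteToBoundary iInter_siteToBoundary_subset_percolatesAt exists_subset_box)
open scoped ENNReal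

variable {ι : Type*}

/-! ### Abstract limit interchanges on local events -/

/-- **A `μ`-null intersection of local events forces `μ_L(E_L) → 0`** for events `E_L` eventually
inside each of them (the passage to the limit of Aizenman–Duminil-Copin–Sidoravicius 2015, §3.2,
remark after (3.11)). Here `μ` is a finite measure with `μ_L(A) → μ(A)` on local events `A`. [cite: AizenmanDuminilCopinSidoraviciusCMP2015, §3.2, remark after eq. (3.11)] -/
theorem tendsto_measure_zero_of_eventually_subset {μs : ℕ → Measure (Set ι)} {μ : Measure (Set ι)}
    [IsFiniteMeasure μ]
    (hμ : ∀ A : Set (Set ι), IsLocalEvent A → Tendsto (fun L => μs L A) atTop (𝓝 (μ A)))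
    (A : ℕ → Set (Set ι)) (hA : ∀ n, IsLocalEvent (A n)) (hnull : μ (⋂ n, A n) = 0)
    (E : ℕ → Set (Set ι)) (hE : ∀ n, ∀ᶠ L in atTop, E L ⊆ A n) :
    Tendsto (fun L => μs L (E L)) atTop (𝓝 0) := by
  classical
  -- the decreasing local events `F n = ⋂_{k ≤ n} A k`
  set F : ℕ → Set (Set ι) := fun n => ⋂ k ∈ Finset.range (n + 1), A k with hF
  have hFlocal : ∀ n, IsLocalEvent (F n) := by
    intro n
    simp only [hF]
    induction (Finset.range (n + 1)) using Finset.induction_on with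
    | empty => simpa using isLocalEvent_univ
    | insert a s ha ih =>
      rw [Finset.set_biInter_insert]
      obtain ⟨F₁, hF₁⟩ := hA a
      obtain ⟨F₂, hF₂⟩ := ih
      exact ⟨F₁ ∪ F₂, by
        rw [Finset.coe_union]
        exact (hF₁.mono Set.subset_union_left).inter (hF₂.mono Set.subset_union_right)⟩
  have hFanti : Antitone F := by
    intro m n hmn ω hω
    simp only [hF, Set.mem_iInter, Finset.mem_range] at hω ⊢
    exact fun k hk => hω k (by omega)
  have hFcap : ⋂ n, F n = ⋂ n, A n := by
    ext ω
    simp only [hF, Set.mem_iInter, Finset.mem_range]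
    exact ⟨fun h n => h n n (Nat.lt_succ_self n), fun h n k _ => h k⟩
  -- `μ(F n) → 0`
  have hFtend : Tendsto (fun n => μ (F n)) atTop (𝓝 0) := by
    have h := tendsto_measure_iInter_atTop (μ := μ)
      (fun n => (measurableSet_of_isLocalEvent_holds (hFlocal n)).nullMeasurableSet) hFanti
      ⟨0, measure_ne_top _ _⟩
    rwa [hFcap, hnull] at h
  rw [ENNReal.tendsto_nhds_zero]
  intro ε hε
  -- choose `n` with `μ(F n) < ε`, then `L` large
  obtain ⟨n, hn⟩ : ∃ n, μ (F n) < ε := by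
    rcases eq_or_ne ε ⊤ with rfl | hεtop
    · exact ⟨0, measure_lt_top _ _⟩
    have := (ENNReal.tendsto_nhds_zero.1 hFtend) (ε / 2) (ENNReal.half_pos hε.ne')
    obtain ⟨n, hn⟩ := this.exists
    exact ⟨n, lt_of_le_of_lt hn (ENNReal.half_lt_self hε.ne' hεtop)⟩
  have hL1 : ∀ᶠ L in atTop, μs L (F n) < ε :=
    (hμ (F n) (hFlocal n)).eventually (gt_mem_nhds hn)
  have hL2 : ∀ᶠ L in atTop, E L ⊆ F n := by
    have h : ∀ᶠ L in atTop, ∀ k ∈ Finset.range (n + 1), E L ⊆ A k :=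
      (Filter.eventually_all_finset _).2 fun k _ => hE k
    filter_upwards [h] with L hL
    simp only [hF]
    exact Set.subset_iInter₂ fun k hk => hL k hk
  filter_upwards [hL1, hL2] with L h1 h2
  exact ((measure_mono h2).trans h1.le)

/-- **An increasing union of local events**: if `A = ⋃ₙ Aₙ` with `Aₙ` local and increasing, and
`μ_L(Aₙ) ≤ τ` for every `n` and all large `L`, then `μ(A) ≤ τ` (continuity from below and the
local limit; the passage to the limit of Aizenman–Duminil-Copin–Sidoravicius 2015, proof of
Thm. 3.1, after (3.3)). [cite: AizenmanDuminilCopinSidoraviciusCMP2015, proof of Thm. 3.1, after eq. (3.3)] -/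
theorem measure_iUnion_le_of_eventually_le {μs : ℕ → Measure (Set ι)} {μ : Measure (Set ι)}
    (hμ : ∀ A : Set (Set ι), IsLocalEvent A → Tendsto (fun L => μs L A) atTop (𝓝 (μ A)))
    (A : ℕ → Set (Set ι)) (hA : ∀ n, IsLocalEvent (A n)) (hmono : Monotone A) {τ : ℝ≥0∞}
    (h : ∀ n, ∀ᶠ L in atTop, μs L (A n) ≤ τ) : μ (⋃ n, A n) ≤ τ := by
  have hlim : Tendsto (fun n => μ (A n)) atTop (𝓝 (μ (⋃ n, A n))) :=
    tendsto_measure_iUnion_atTop hmono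
  refine le_of_tendsto' hlim fun n => ?_
  exact le_of_tendsto (hμ (A n) (hA n)) (h n)

/-! ### Box-constrained connections on `ℤ^d` -/

section Lattice

variable {d : ℕ}

/-- The box-constrained connection `{x ↔ y inside Λ_N}` (steps inside the box) is a local event,
determined by the pairs of sites of `Λ_N`. [folklore] -/
theorem isLocalEvent_openConnVia_withinGraph_box (N : ℕ) (x y : LatticeModels.Site d) :
    IsLocalEvent (openConnVia (withinGraph ⊤ (↑(LatticeModels.box d N) : Set (LatticeModels.Site d))) x y) := by
  refine ⟨(LatticeModels.box d N).sym2, (determinedBy_openConnVia _ x y).mono ?_⟩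
  intro e he
  induction e using Sym2.ind with
  | _ u v =>
    have h := (mem_edgeSet_withinGraph.1 he)
    rw [Finset.mem_coe, Finset.mk_mem_sym2_iff]
    exact ⟨h.2.1, h.2.2⟩

/-- A walk all of whose vertices lie in `S` is a walk of steps inside `S`. [folklore] -/
theorem reachable_inf_withinGraph_of_walk {ω : BondConfig (LatticeModels.Site d)} {S : Set (LatticeModels.Site d)} {x y : LatticeModels.Site d}
    (w : (openGraph ω).Walk x y) (hw : ∀ v ∈ w.support, v ∈ S) :
    (openGraph ω ⊓ withinGraph ⊤ S).Reachable x y := by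
  induction w with
  | nil => rfl
  | @cons u v z huv w ih =>
    have hu : u ∈ S := hw u (by simp)
    have hv : v ∈ S := hw v (by simp)
    have h1 : (openGraph ω ⊓ withinGraph ⊤ S).Adj u v := by
      rw [SimpleGraph.inf_adj]
      exact ⟨huv, ⟨huv.ne, hu, hv⟩⟩
    exact h1.reachable.trans (ih fun t ht => hw t (by simp [ht]))

/-- **`{x ↔ y}` is exhausted by the box-constrained connections**:
`{x ↔ y} = ⋃_N {x ↔ y inside Λ_N}` (an open path uses finitely many sites, all in some box). [folklore] -/
theorem openConn_eq_iUnion_openConnVia_box (x y : LatticeModels.Site d) :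
    (openConn x y : Set (BondConfig (LatticeModels.Site d))) =
      ⋃ N, openConnVia (withinGraph ⊤ (↑(LatticeModels.box d N) : Set (LatticeModels.Site d))) x y := by
  classical
  ext ω
  simp only [Set.mem_iUnion]
  constructor
  · intro h
    obtain ⟨w⟩ := (h : (openGraph ω).Reachable x y)
    obtain ⟨N, hN⟩ := exists_subset_box w.support.toFinset
    refine ⟨N, ?_⟩
    show y ∈ openClusterIn _ ω x
    rw [mem_openClusterIn_iff]
    exact reachable_inf_withinGraph_of_walk w fun v hv => by
      exact_mod_cast hN (List.mem_toFinset.2 hv)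
  · rintro ⟨N, hN⟩
    exact openClusterIn_subset_openCluster _ ω x hN

/-- The box-constrained connections increase with the box. [folklore] -/
theorem monotone_openConnVia_withinGraph_box (x y : LatticeModels.Site d) :
    Monotone fun N => (openConnVia (withinGraph ⊤ (↑(LatticeModels.box d N) : Set (LatticeModels.Site d))) x y :
      Set (BondConfig (LatticeModels.Site d))) :=
  fun _ _ hMN => openConnVia_mono_graph
    (withinGraph_mono ⊤ (by exact_mod_cast LatticeModels.box_mono d hMN)) x y

/-- **`μ[x ↔ y] ≤ τ` from finite-volume box-constrained bounds** (Aizenman–Duminil-Copin–Sidoravicius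
2015, proof of Thm. 3.1, (3.3) ⇒ `ℙ_β[x ↔ y] ≤ ⟨σ_xσ_y⟩⁰_β`): if `μ` is the local limit of `μ_L`
and `μ_L[x ↔ y inside Λ_N] ≤ τ` for every `N` and all large `L`, then `μ[x ↔ y] ≤ τ`. [cite: AizenmanDuminilCopinSidoraviciusCMP2015, proof of Thm. 3.1, eq. (3.3) and the following limit] -/
theorem measure_openConn_le_of_eventually_le {μs : ℕ → Measure (BondConfig (LatticeModels.Site d))}
    {μ : Measure (BondConfig (LatticeModels.Site d))}
    (hμ : ∀ A : Set (BondConfig (LatticeModels.Site d)), IsLocalEvent A → Tendsto (fun L => μs L A) atTop (𝓝 (μ A)))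
    {x y : LatticeModels.Site d} {τ : ℝ≥0∞}
    (h : ∀ N, ∀ᶠ L in atTop, μs L (openConnVia (withinGraph ⊤ (↑(LatticeModels.box d N) : Set (LatticeModels.Site d))) x y) ≤ τ) :
    μ (openConn x y) ≤ τ := by
  rw [openConn_eq_iUnion_openConnVia_box]
  exact measure_iUnion_le_of_eventually_le hμ _ (fun N => isLocalEvent_openConnVia_withinGraph_box N x y)
    (monotone_openConnVia_withinGraph_box x y) h

/-! ### The translated one-arm events and the vanishing of exit probabilities -/

/-- Local events pull back to local events under the lattice translations of configurations. [folklore] -/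
theorem IsLocalEvent.preimage_relabel_shift (v : LatticeModels.Site d) {A : Set (BondConfig (LatticeModels.Site d))}
    (hA : IsLocalEvent A) : IsLocalEvent (BondConfig.relabel (sym2Equiv (LatticeModels.Site.shift v)) ⁻¹' A) := by
  classical
  obtain ⟨F, hF⟩ := hA
  refine ⟨F.map (sym2Equiv (LatticeModels.Site.shift v)).symm.toEmbedding, ?_⟩
  rw [determinedBy_iff] at hF ⊢
  intro ω ω' hω
  simp only [Set.mem_preimage]
  refine hF _ _ ?_
  ext z
  simp only [Set.mem_inter_iff, Finset.mem_coe]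
  have key : ∀ z ∈ F, (z ∈ BondConfig.relabel (sym2Equiv (LatticeModels.Site.shift v)) ω ↔
      z ∈ BondConfig.relabel (sym2Equiv (LatticeModels.Site.shift v)) ω') := by
    intro z hz
    rw [BondConfig.mem_relabel_iff, BondConfig.mem_relabel_iff]
    have hz' : (sym2Equiv (LatticeModels.Site.shift v)).symm z ∈
        (↑(F.map (sym2Equiv (LatticeModels.Site.shift v)).symm.toEmbedding) : Set (Sym2 (LatticeModels.Site d))) := by
      rw [Finset.coe_map]; exact ⟨z, hz, rfl⟩
    have := Set.ext_iff.1 hω ((sym2Equiv (LatticeModels.Site.shift v)).symm z)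
    simp only [Set.mem_inter_iff, hz', and_true] at this
    exact this
  constructor
  · rintro ⟨h1, h2⟩; exact ⟨(key z h2).1 h1, h2⟩
  · rintro ⟨h1, h2⟩; exact ⟨(key z h2).2 h1, h2⟩

/-- The one-arm event `{0 ↔ ∂Λ_n}` is local. [folklore] -/
theorem isLocalEvent_siteToBoundary (d n : ℕ) : IsLocalEvent (siteToBoundary d n) :=
  ⟨(LatticeModels.box d n).sym2, determinedBy_siteToBoundary d n⟩

/-- The translated one-arm event `{x ↔ ∂(x + Λ_n) inside x + Λ_n}` (`DCT16.armEvent`) is local. [folklore] -/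
theorem isLocalEvent_armEvent (x : LatticeModels.Site d) (n : ℕ) : IsLocalEvent (armEvent x n) := by
  rw [← preimage_shift_siteToBoundary x n]
  exact (isLocalEvent_siteToBoundary d n).preimage_relabel_shift (-x)

/-- **`⋂ₙ {x ↔ ∂(x + Λ_n)} ⊆ {x ↔ ∞}`**: translate `iInter_siteToBoundary_subset_percolatesAt`. [folklore] -/
theorem iInter_armEvent_subset_percolatesAt (x : LatticeModels.Site d) :
    ⋂ n, armEvent x n ⊆ (percolatesAt x : Set (BondConfig (LatticeModels.Site d))) := by
  intro ω hω
  have h0 : BondConfig.relabel (sym2Equiv (LatticeModels.Site.shift (-x))) ω ∈ ⋂ n, siteToBoundary d n := by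
    rw [Set.mem_iInter] at hω ⊢
    intro n
    have := hω n
    rw [← preimage_shift_siteToBoundary x n] at this
    exact this
  have hperc := iInter_siteToBoundary_subset_percolatesAt d h0
  have h := relabel_mem_percolatesAt_iff (LatticeModels.Site.shift (-x)) ω x
  have hx0 : LatticeModels.Site.shift (-x) x = 0 := by simp [LatticeModels.Site.shift_apply]
  rw [hx0] at h
  exact h.1 hperc

/-- **Vanishing of exit probabilities** (Aizenman–Duminil-Copin–Sidoravicius 2015, §3.2, remark
after (3.11): `limsup_L ℙ_{Λ_L,β}[x ↔ δ] ≤ inf_N ℙ_β[x ↔ ∂(x+Λ_N)] = ℙ_β[x ↔ ∞] = 0`): if `μ` is a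
finite measure with `μ_L(A) → μ(A)` on local events, `μ[x ↔ ∞] = 0`, and the events `E_L` satisfy
`E_L ⊆ {x ↔ ∂(x + Λ_n)}` for each `n` and all large `L`, then `μ_L(E_L) → 0`. [cite: AizenmanDuminilCopinSidoraviciusCMP2015, §3.2, remark after eq. (3.11)] -/
theorem tendsto_measure_zero_of_subset_armEvent {μs : ℕ → Measure (BondConfig (LatticeModels.Site d))}
    {μ : Measure (BondConfig (LatticeModels.Site d))} [IsFiniteMeasure μ]
    (hμ : ∀ A : Set (BondConfig (LatticeModels.Site d)), IsLocalEvent A → Tendsto (fun L => μs L A) atTop (𝓝 (μ A)))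
    {x : LatticeModels.Site d} (hperc : μ (percolatesAt x) = 0) (E : ℕ → Set (BondConfig (LatticeModels.Site d)))
    (hE : ∀ n, ∀ᶠ L in atTop, E L ⊆ armEvent x n) :
    Tendsto (fun L => μs L (E L)) atTop (𝓝 0) :=
  tendsto_measure_zero_of_eventually_subset hμ (armEvent x) (isLocalEvent_armEvent x)
    (measure_mono_null (iInter_armEvent_subset_percolatesAt x) hperc) E hE

end Lattice

end Literature.Probability.Percolation
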